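import Summits.ValiantsHypothesis.ValiantsHypothesis.Theorems.KPlusLogSqLawTropicalBBoundarySectorDefs
import Summits.ValiantsHypothesis.ValiantsHypothesis.Theorems.KPlusLogSqLawTropicalShiftThreeDefs

/-!
# Route «KPlusLogSqLaw», crux `TropicalB` (stmt-ValiantsHypothesis-19771) — the TWO-BOUNDARY PORT of SHIFT-THREE: definitions

HONEST FRAMING.  Definitions file (D-0009) for the support theorems of `…TropicalBTwoBoundaryPort` /
`…TropicalBTwoBoundaryQuadratic` (seat val-sym-trop-p1 g17, cell `pub-symmetroid`, 2026-08-28), toward the registered stubs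
`stub_tropThin` / `stub_tropFat` of `Cruxes/TropicalB/Lines/birth.lean` (crux `TropicalB`, item `stmt-ValiantsHypothesis-19771`).
It names ONE explicit DENSE boundary-type design with TWO boundaries (`BoundarySector.IsBoundaryDesign`, p447010) per size
`2m`, `m = n + 1`, into which the `K = 3` family SHIFT-THREE (`TropicalCensus.ShiftThree`, val-sym-lift-p3) embeds with all its
`C(m+2,2) − 1` unique optima; the companion files prove the embedding and conclude `¬ BoundaryVertexLaw 2 1` (the two-boundary
sector is at least QUADRATIC, against the located guess «BVL(2,1) linear» of HOME/val-sym-trop-p1/g15–g16).  Nothing is proved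
here; nothing asserts `TropicalB`, `WeakLifting`, `KPlusLogSqLaw`, `MatrixDescartes` or anything on VP ≠ VNP.

THE DESIGN (rows and columns `Fin (m + m)`: REAL indices `Fin.castAdd m a`, PARTNER indices `Fin.natAdd m b`).
* Boundaries: `bd 0 = 1` (both keys the identity: bit `[x < y]`) and `bd 1 = finAddFlip` (both keys swap the two halves).
  Hence (`…TwoBoundaryPort`): real/real entry `(a, b)` has pattern `([a<b],[a<b])`; partner row `b'` to real column `b`: `(0,1)`;
  real row to partner column: `(1,0)`; partner/partner `(b', c)`: `([b'<c],[b'<c])`.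
* Labelling `lab3`: `00 ↦ 0`, `11 ↦ 2`, `01 ↦ 1`, `10 ↦ 0`; exponents = SHIFT-THREE's `dd = (0, 1, D)`.
* Valuations `bigV`: real/real = SHIFT-THREE's `vv` (the wrap class only ever reads `pen`); partner row `b'` to real column `b`:
  `0` if `b' = b` (the TOGGLE cell, class `1`), else `huge`; real row `a` to partner column `c`: `vv a c 1` (the partner carries the
  class-`1` PRICE of the cell it stands in for); partner/partner: `0` on the diagonal (partner at home), else `huge`.
* Signs `bigE`: `+1` exactly on the pattern's class (dense, `IsBoundaryDesign` by construction).
* Term map `bigTerm (σ, μ)`: a column `b` with `μ b = 1` is TOGGLED — real column `b` sits on its partner row, partner column `b`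
  on the real row `σ b`; otherwise real column `b` sits on real row `σ b` and partner column `b` at home.  So a class-`1` entry of
  SHIFT-THREE becomes a pair (toggle cell, priced partner cell) and the tropical weight is preserved.
* Certificate data for `isDominant_of_scaledPotential` (scale `2`) at the grid slope `θ = th p a`: `G p a b` = SHIFT-THREE's
  corrected score `phi` of the grid entry of column `b`; row potentials `potU`, column potentials `potW` (formulas below).
-/

set_option linter.dupNamespace false
set_option autoImplicit false

namespace Summit.ValiantsHypothesis.ValiantsHypothesis.Theorems.KPlusLogSqLaw

namespace BoundarySector

namespace TwoPort

open Summit.ValiantsHypothesis.ValiantsHypothesis.Theorems.LacunarySymmetroidMatrixDescartes.TropicalCensus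

variable (n : ℕ)

/-- the two boundaries: key pair `0` is the identity (bit `[x < y]`), key pair `1` swaps the real and partner halves. -/
def bd (j : Fin 2) : Equiv.Perm (Fin ((n + 1) + (n + 1))) := if j = 0 then 1 else finAddFlip

/-- the labelling of the four patterns: `00 ↦ 0`, `11 ↦ 2`, `01 ↦ 1`, `10 ↦ 0`. -/
def lab3 (f : Fin 2 → Bool) : Fin 3 :=
  if f 0 = f 1 then (if f 0 = true then 2 else 0) else (if f 1 = true then 1 else 0)

/-- the large valuation of the junk cells. -/
def huge : ℤ := 32 * ((n : ℤ) + 3) ^ 4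

/-- valuations on the structured index type (real = `inl`, partner = `inr`). -/
def valS : (Fin (n + 1) ⊕ Fin (n + 1)) → (Fin (n + 1) ⊕ Fin (n + 1)) → Fin 3 → ℤ
  | Sum.inl a, Sum.inl b, l => ShiftThree.vv n a b l
  | Sum.inr b', Sum.inl b, _ => if b' = b then 0 else huge n
  | Sum.inl a, Sum.inr c, _ => ShiftThree.vv n a c 1
  | Sum.inr b', Sum.inr c, _ => if b' = c then 0 else huge n

/-- valuations of the two-boundary port. -/
def bigV (x y : Fin ((n + 1) + (n + 1))) (l : Fin 3) : ℤ := valS n (finSumFinEquiv.symm x) (finSumFinEquiv.symm y) l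

/-- signs of the two-boundary port: `+1` exactly on the class of the entry's pattern. -/
def bigE (x y : Fin ((n + 1) + (n + 1))) (l : Fin 3) : ℤ := if l = lab3 (pattern (bd n) (bd n) x y) then 1 else 0

/-- the toggle involution on the structured index type: columns `b` with `μ b = 1` swap their real and partner copies. -/
def toggleFun (μ : Fin (n + 1) → Fin 3) : (Fin (n + 1) ⊕ Fin (n + 1)) → (Fin (n + 1) ⊕ Fin (n + 1))
  | Sum.inl b => if μ b = 1 then Sum.inr b else Sum.inl b
  | Sum.inr b => if μ b = 1 then Sum.inl b else Sum.inr b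

/-- the toggle map is an involution. -/
theorem toggleFun_involutive (μ : Fin (n + 1) → Fin 3) : Function.Involutive (toggleFun n μ) := by
  intro x
  rcases x with b | b <;> by_cases h : μ b = 1 <;> simp [toggleFun, h]

/-- the toggle involution as a permutation. -/
def toggle (μ : Fin (n + 1) → Fin 3) : Equiv.Perm (Fin (n + 1) ⊕ Fin (n + 1)) :=
  (toggleFun_involutive n μ).toPerm _

/-- the big permutation of the term `(σ, μ)` (columns ↦ rows). -/
def bigPerm (σ : Equiv.Perm (Fin (n + 1))) (μ : Fin (n + 1) → Fin 3) : Equiv.Perm (Fin ((n + 1) + (n + 1))) :=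
  finSumFinEquiv.symm.trans (((toggle n μ).trans (Equiv.sumCongr σ (Equiv.refl _))).trans finSumFinEquiv)

/-- the big class map of the term `(σ, μ)`: forced by the patterns. -/
def bigCls (σ : Equiv.Perm (Fin (n + 1))) (μ : Fin (n + 1) → Fin 3) (y : Fin ((n + 1) + (n + 1))) : Fin 3 :=
  lab3 (pattern (bd n) (bd n) (bigPerm n σ μ y) y)

/-- the image of a SHIFT-THREE term in the two-boundary port. -/
def bigTerm (q : Equiv.Perm (Fin (n + 1)) × (Fin (n + 1) → Fin 3)) :
    Equiv.Perm (Fin ((n + 1) + (n + 1))) × (Fin ((n + 1) + (n + 1)) → Fin 3) :=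
  (bigPerm n q.1 q.2, bigCls n q.1 q.2)

/-- the corrected score of the grid entry of column `b` at the grid point `(p, a)` (SHIFT-THREE's `phi`). -/
def G (p a : ℕ) (b : Fin (n + 1)) : ℤ := ShiftThree.phi n (ShiftThree.th n p a) (ShiftThree.rot n p b) b (ShiftThree.lam n p a b)

/-- row potentials of the scale-`2` certificate at the grid point `(p, a)`. -/
def potUS (p a : ℕ) : (Fin (n + 1) ⊕ Fin (n + 1)) → ℤ
  | Sum.inl a' => -(2 * ShiftThree.th n p a * (2 * n + 5) * (a' : ℤ))
  | Sum.inr b => 2 * ShiftThree.th n p a - 2 * G n p a b - 2 * ShiftThree.th n p a * (2 * n + 5) * (b : ℤ) + 1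

/-- column potentials of the scale-`2` certificate at the grid point `(p, a)`. -/
def potWS (p a : ℕ) : (Fin (n + 1) ⊕ Fin (n + 1)) → ℤ
  | Sum.inl b => 2 * G n p a b + 2 * ShiftThree.th n p a * (2 * n + 5) * (b : ℤ) - (if ShiftThree.lam n p a b = 1 then 1 else 0)
  | Sum.inr b => 2 * G n p a b - 2 * ShiftThree.th n p a + 2 * ShiftThree.th n p a * (2 * n + 5) * (b : ℤ) - (if ShiftThree.lam n p a b = 1 then 0 else 1)

/-- row potentials on `Fin (m + m)`. -/
def potU (p a : ℕ) (x : Fin ((n + 1) + (n + 1))) : ℤ := potUS n p a (finSumFinEquiv.symm x)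

/-- column potentials on `Fin (m + m)`. -/
def potW (p a : ℕ) (y : Fin ((n + 1) + (n + 1))) : ℤ := potWS n p a (finSumFinEquiv.symm y)

end TwoPort

end BoundarySector

end Summit.ValiantsHypothesis.ValiantsHypothesis.Theorems.KPlusLogSqLaw
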